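import Summits.NavierStokesRegularity.NavierStokesRegularity.Theorems.AdaptedFrequencyFrequencyRigidityKernelCompactnessExtract
import Mathlib.Analysis.Distribution.AEEqOfIntegralContDiff
import HarnessLib

/-!
# Crux `FrequencyRigidity` (stmt-NavierStokesRegularity-2955), line `moving-adjoint-bernoulli`:
  STUB `stub_kernelCompactness` (S4) — compactness of adapted kernels on growing windows

Lands `--supports stmt-NavierStokesRegularity-2955` the registered stub `stub_kernelCompactness`,
the compactness ENGINE of the wall: for ONE smooth divergence-free drift `v` on `(−∞, 0) × ℝ³`,
locally bounded, a sequence of adapted backward kernels `Kₙ` of `∂ₜ + v·∇ − νΔ` on the growing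
windows `[−n−1, 0)` (pole `(0, 0)`), all squeezed between the SAME two Gaussians, has a
subsequence converging at every `(t, x)`, `t < 0`, to an adapted kernel `G` on `(−∞, 0)` between
the same Gaussians.

Proof (the passage to the limit of `kernelLimit_of_hypoelliptic`, file
`…AdaptedKernelExistsKernelLimit.lean`, run on the growing windows; the subsequence comes from
part 1, `kernelCompactness_extract` of `…KernelCompactnessExtract.lean`):
* `kernelCompactness_continuous_slice`, `kernelCompactness_pairing_continuousOn` — the limit has
  continuous slices and pairings continuous in time (the two uniform moduli pass to the limit,
  `kernelCompactness_pairing_tendsto`);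
* `kernelCompactness_limit_slice` — the two-sided bounds, positivity and unit mass pass to the
  limit (dominated convergence under the Gaussian majorant, `kernelLimit_envelope_integral`);
* `kernelCompactness_window` — on each window `(a, 0)` the limit is a very weak solution
  (`kernelLimit_veryWeak_of_adapted`, `kernelLimit_veryWeak_limit`), hence a.e. equal to a smooth
  classical solution (`stub_hypoelliptic`); since pairings and slices of both are continuous, the
  limit EQUALS the smooth solution everywhere on the window (fundamental lemma of the calculus of
  variations slice by slice), so the limit itself is smooth and solves the adjoint equation;
* `stub_kernelCompactness` — assembly on `Iio 0 = ⋃ₐ (a, 0)`; concentration at the pole from the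
  Gaussian upper bound and unit mass (`kernelLimit_concentration`).
-/

set_option linter.dupNamespace false

noncomputable section

open MeasureTheory Set Filter Topology Metric Function
open scoped Laplacian ContDiff
open Literature.Analysis.FluidPDE
open Summit.NavierStokesRegularity.NavierStokesRegularity.Theorems.AdaptedKernelExists.NashEntropyLastBlock

namespace Summit.NavierStokesRegularity.NavierStokesRegularity.Theorems.FrequencyRigidity.MovingAdjointBernoulli

/-! ### The limit: slices, pairings, bounds and mass -/

/-- **Pairings converge along the subsequence**: for a continuous compactly supported `ψ` and
`t < 0`, `∫ψK_{φ(k)}(t) → ∫ψG(t)` (dominated convergence under the uniform sup bound). -/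
theorem kernelCompactness_pairing_tendsto {ν C₁ C₂ : ℝ}
    {v : ℝ → EuclideanSpace ℝ (Fin 3) → EuclideanSpace ℝ (Fin 3)}
    {K : ℕ → ℝ → EuclideanSpace ℝ (Fin 3) → ℝ} (hC₁ : 0 < C₁) (hC₂ : 0 < C₂)
    (hK : ∀ n : ℕ, IsAdaptedBackwardKernel ν v (Ico (-(n:ℝ) - 1) 0) 0 0 (K n))
    (hKU : ∀ n : ℕ, ∀ t ∈ Ico (-(n:ℝ) - 1) (0:ℝ), ∀ x,
      K n t x ≤ C₁ * ((0:ℝ) - t) ^ (-(3:ℝ) / 2) *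
        Real.exp (-(‖x - (0 : EuclideanSpace ℝ (Fin 3))‖ ^ 2) / (C₂ * ((0:ℝ) - t))))
    {φ : ℕ → ℕ} (hφ : StrictMono φ) {Glim : ℝ → EuclideanSpace ℝ (Fin 3) → ℝ}
    (hconv : ∀ t < (0:ℝ), ∀ x, Tendsto (fun k => K (φ k) t x) atTop (𝓝 (Glim t x)))
    {ψ : EuclideanSpace ℝ (Fin 3) → ℝ} (hψ : Continuous ψ) (hψc : HasCompactSupport ψ)
    {t : ℝ} (ht : t < 0) :
    Tendsto (fun k => ∫ x, ψ x * K (φ k) t x) atTop (𝓝 (∫ x, ψ x * Glim t x)) := by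
  set M : ℝ := C₁ * ((0:ℝ) - t) ^ (-(3:ℝ) / 2) with hM
  have hev := kernelCompactness_eventually_lt hφ t
  refine tendsto_integral_filter_of_dominated_convergence (fun x => ‖ψ x‖ * M) ?_ ?_ ?_ ?_
  · filter_upwards [hev] with k hk
    exact (hψ.mul ((hK (φ k)).contDiff_slice ⟨hk.le, ht⟩).continuous).aestronglyMeasurable
  · filter_upwards [hev] with k hk
    refine Eventually.of_forall fun x => ?_
    rw [norm_mul, Real.norm_eq_abs (K (φ k) t x)]
    exact mul_le_mul_of_nonneg_left
      (kernelCompactness_sup_bound hC₁ hC₂ hK hKU ht (φ k) ⟨hk.le, le_rfl⟩ x) (norm_nonneg _)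
  · exact (hψ.norm.integrable_of_hasCompactSupport hψc.norm).mul_const M
  · exact Eventually.of_forall fun x => (hconv t ht x).const_mul (ψ x)

/-- **The slices of the limit are continuous** (the uniform spatial modulus passes to the
limit). -/
theorem kernelCompactness_continuous_slice {ν C₁ C₂ : ℝ}
    {v : ℝ → EuclideanSpace ℝ (Fin 3) → EuclideanSpace ℝ (Fin 3)}
    {K : ℕ → ℝ → EuclideanSpace ℝ (Fin 3) → ℝ} (hν : 0 < ν) (hC₁ : 0 < C₁) (hC₂ : 0 < C₂)
    (hv : IsSmoothSpaceTimeOn (Iio 0) v)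
    (hbd : ∀ a b : ℝ, a < b → b < 0 → ∃ B : ℝ, ∀ t ∈ Icc a b, ∀ x, ‖v t x‖ ≤ B)
    (hK : ∀ n : ℕ, IsAdaptedBackwardKernel ν v (Ico (-(n:ℝ) - 1) 0) 0 0 (K n))
    (hKU : ∀ n : ℕ, ∀ t ∈ Ico (-(n:ℝ) - 1) (0:ℝ), ∀ x,
      K n t x ≤ C₁ * ((0:ℝ) - t) ^ (-(3:ℝ) / 2) *
        Real.exp (-(‖x - (0 : EuclideanSpace ℝ (Fin 3))‖ ^ 2) / (C₂ * ((0:ℝ) - t))))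
    {φ : ℕ → ℕ} (hφ : StrictMono φ) {Glim : ℝ → EuclideanSpace ℝ (Fin 3) → ℝ}
    (hconv : ∀ t < (0:ℝ), ∀ x, Tendsto (fun k => K (φ k) t x) atTop (𝓝 (Glim t x)))
    {t : ℝ} (ht : t < 0) : Continuous (Glim t) := by
  rw [Metric.continuous_iff]
  intro x ε hε
  obtain ⟨δ, hδ, hmod⟩ :=
    kernelCompactness_space_modulus hν hC₁ hC₂ hv hbd hK hKU ht x (half_pos hε)
  refine ⟨δ, hδ, fun y hy => ?_⟩
  rw [dist_eq_norm] at hy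
  rw [Real.dist_eq]
  have hlim : Tendsto (fun k => |K (φ k) t y - K (φ k) t x|) atTop
      (𝓝 |Glim t y - Glim t x|) :=
    (continuous_abs.tendsto _).comp ((hconv t ht y).sub (hconv t ht x))
  have hle : |Glim t y - Glim t x| ≤ ε / 2 := by
    refine le_of_tendsto hlim ?_
    filter_upwards [kernelCompactness_eventually_lt hφ t] with k hk
    exact hmod (φ k) hk y hy.le
  linarith

/-- **The pairings of the limit with test functions are continuous in time** on `(−∞, 0)`
(they are Lipschitz on compact sub-intervals: the uniform Lipschitz bound of
`kernelCompactness_pairing_lipschitz` passes to the limit by `kernelCompactness_pairing_tendsto`). -/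
theorem kernelCompactness_pairing_continuousOn {ν C₁ C₂ : ℝ}
    {v : ℝ → EuclideanSpace ℝ (Fin 3) → EuclideanSpace ℝ (Fin 3)}
    {K : ℕ → ℝ → EuclideanSpace ℝ (Fin 3) → ℝ} (hν : 0 < ν) (hC₁ : 0 < C₁) (hC₂ : 0 < C₂)
    (hv : IsSmoothSpaceTimeOn (Iio 0) v)
    (hdiv : ∀ t ∈ Iio (0:ℝ), VectorCalculus.IsDivFree (v t))
    (hbd : ∀ a b : ℝ, a < b → b < 0 → ∃ B : ℝ, ∀ t ∈ Icc a b, ∀ x, ‖v t x‖ ≤ B)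
    (hK : ∀ n : ℕ, IsAdaptedBackwardKernel ν v (Ico (-(n:ℝ) - 1) 0) 0 0 (K n))
    (hKU : ∀ n : ℕ, ∀ t ∈ Ico (-(n:ℝ) - 1) (0:ℝ), ∀ x,
      K n t x ≤ C₁ * ((0:ℝ) - t) ^ (-(3:ℝ) / 2) *
        Real.exp (-(‖x - (0 : EuclideanSpace ℝ (Fin 3))‖ ^ 2) / (C₂ * ((0:ℝ) - t))))
    {φ : ℕ → ℕ} (hφ : StrictMono φ) {Glim : ℝ → EuclideanSpace ℝ (Fin 3) → ℝ}
    (hconv : ∀ t < (0:ℝ), ∀ x, Tendsto (fun k => K (φ k) t x) atTop (𝓝 (Glim t x)))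
    {ψ : EuclideanSpace ℝ (Fin 3) → ℝ} (hψ : ContDiff ℝ ∞ ψ) (hψc : HasCompactSupport ψ) :
    ContinuousOn (fun t => ∫ x, ψ x * Glim t x) (Iio 0) := by
  intro t ht
  have ht0 : t < 0 := ht
  set t₁ : ℝ := t - 1 with ht₁
  set t₂ : ℝ := t / 2 with ht₂
  have h₁₂ : t₁ ≤ t₂ := by rw [ht₁, ht₂]; linarith
  have h₂ : t₂ < 0 := by rw [ht₂]; linarith
  obtain ⟨L, -, hL⟩ := kernelCompactness_pairing_lipschitz hν hv hdiv hbd hK hψ hψc h₁₂ h₂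
  have hP : ∀ s : ℝ, s < 0 → Tendsto (fun k => ∫ x, ψ x * K (φ k) s x) atTop
      (𝓝 (∫ x, ψ x * Glim s x)) := fun s hs =>
    kernelCompactness_pairing_tendsto hC₁ hC₂ hK hKU hφ hconv hψ.continuous hψc hs
  have key : ∀ s ∈ Icc t₁ t₂, ∀ s' ∈ Icc t₁ t₂,
      |(∫ x, ψ x * Glim s' x) - ∫ x, ψ x * Glim s x| ≤ L * |s' - s| := by
    intro s hs s' hs'
    have hlim := (continuous_abs.tendsto _).comp
      ((hP s' (hs'.2.trans_lt h₂)).sub (hP s (hs.2.trans_lt h₂)))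
    refine le_of_tendsto hlim ?_
    filter_upwards [kernelCompactness_eventually_lt hφ t₁] with k hk
    exact hL (φ k) t₁ hk le_rfl s hs s' hs'
  have hLip : LipschitzOnWith (Real.toNNReal L) (fun r => ∫ x, ψ x * Glim r x) (Icc t₁ t₂) :=
    LipschitzOnWith.of_dist_le' fun s hs s' hs' => by
      rw [Real.dist_eq, Real.dist_eq]; exact key s' hs' s hs
  exact (hLip.continuousOn.continuousAt
    (Icc_mem_nhds (by rw [ht₁]; linarith) (by rw [ht₂]; linarith))).continuousWithinAt

/-- **Bounds, positivity, integrability and unit mass of the limit slices** (`t < 0`): the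
two-sided Gaussian bounds pass to pointwise limits, and the mass by dominated convergence under
the Gaussian majorant (`kernelLimit_envelope_integral`). -/
theorem kernelCompactness_limit_slice {ν c₁ c₂ C₁ C₂ : ℝ}
    {v : ℝ → EuclideanSpace ℝ (Fin 3) → EuclideanSpace ℝ (Fin 3)}
    {K : ℕ → ℝ → EuclideanSpace ℝ (Fin 3) → ℝ} (hc₁ : 0 < c₁) (hC₂ : 0 < C₂)
    (hK : ∀ n : ℕ, IsAdaptedBackwardKernel ν v (Ico (-(n:ℝ) - 1) 0) 0 0 (K n))
    (hKB : ∀ n : ℕ, ∀ t ∈ Ico (-(n:ℝ) - 1) (0:ℝ), ∀ x,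
      c₁ * ((0:ℝ) - t) ^ (-(3:ℝ) / 2) *
          Real.exp (-(‖x - (0 : EuclideanSpace ℝ (Fin 3))‖ ^ 2) / (c₂ * ((0:ℝ) - t))) ≤ K n t x ∧
        K n t x ≤ C₁ * ((0:ℝ) - t) ^ (-(3:ℝ) / 2) *
          Real.exp (-(‖x - (0 : EuclideanSpace ℝ (Fin 3))‖ ^ 2) / (C₂ * ((0:ℝ) - t))))
    {φ : ℕ → ℕ} (hφ : StrictMono φ) {Glim : ℝ → EuclideanSpace ℝ (Fin 3) → ℝ}
    (hconv : ∀ t < (0:ℝ), ∀ x, Tendsto (fun k => K (φ k) t x) atTop (𝓝 (Glim t x)))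
    {t : ℝ} (ht : t < 0) (hGc : Continuous (Glim t)) :
    (∀ x, c₁ * ((0:ℝ) - t) ^ (-(3:ℝ) / 2) *
          Real.exp (-(‖x - (0 : EuclideanSpace ℝ (Fin 3))‖ ^ 2) / (c₂ * ((0:ℝ) - t))) ≤ Glim t x ∧
        Glim t x ≤ C₁ * ((0:ℝ) - t) ^ (-(3:ℝ) / 2) *
          Real.exp (-(‖x - (0 : EuclideanSpace ℝ (Fin 3))‖ ^ 2) / (C₂ * ((0:ℝ) - t)))) ∧
      (∀ x, 0 < Glim t x) ∧ Integrable (Glim t) ∧ ∫ x, Glim t x = 1 := by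
  have hev := kernelCompactness_eventually_lt hφ t
  have hB : ∀ x, c₁ * ((0:ℝ) - t) ^ (-(3:ℝ) / 2) *
          Real.exp (-(‖x - (0 : EuclideanSpace ℝ (Fin 3))‖ ^ 2) / (c₂ * ((0:ℝ) - t))) ≤ Glim t x ∧
        Glim t x ≤ C₁ * ((0:ℝ) - t) ^ (-(3:ℝ) / 2) *
          Real.exp (-(‖x - (0 : EuclideanSpace ℝ (Fin 3))‖ ^ 2) / (C₂ * ((0:ℝ) - t))) := fun x =>
    ⟨ge_of_tendsto (hconv t ht x) (by
        filter_upwards [hev] with k hk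
        exact (hKB (φ k) t ⟨hk.le, ht⟩ x).1),
      le_of_tendsto (hconv t ht x) (by
        filter_upwards [hev] with k hk
        exact (hKB (φ k) t ⟨hk.le, ht⟩ x).2)⟩
  have h0t : 0 < (0:ℝ) - t := by linarith
  have hpos : ∀ x, 0 < Glim t x := fun x => lt_of_lt_of_le (by positivity) (hB x).1
  obtain ⟨henv_i, -⟩ :=
    kernelLimit_envelope_integral (C₁ := C₁) hC₂ h0t (0 : EuclideanSpace ℝ (Fin 3))
  have hint : Integrable (Glim t) := by
    refine henv_i.mono' hGc.aestronglyMeasurable (Eventually.of_forall fun x => ?_)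
    rw [Real.norm_eq_abs, abs_of_pos (hpos x)]
    exact (hB x).2
  have hlim : Tendsto (fun k => ∫ x, K (φ k) t x) atTop (𝓝 (∫ x, Glim t x)) := by
    refine tendsto_integral_filter_of_dominated_convergence
      (fun x => C₁ * ((0:ℝ) - t) ^ (-(3:ℝ) / 2) *
        Real.exp (-(‖x - (0 : EuclideanSpace ℝ (Fin 3))‖ ^ 2) / (C₂ * ((0:ℝ) - t)))) ?_ ?_
      henv_i ?_
    · filter_upwards [hev] with k hk
      exact ((hK (φ k)).contDiff_slice ⟨hk.le, ht⟩).continuous.aestronglyMeasurable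
    · filter_upwards [hev] with k hk
      refine Eventually.of_forall fun x => ?_
      rw [Real.norm_eq_abs, abs_of_pos ((hK (φ k)).pos t ⟨hk.le, ht⟩ x)]
      exact (hKB (φ k) t ⟨hk.le, ht⟩ x).2
    · exact Eventually.of_forall fun x => hconv t ht x
  have h1 : Tendsto (fun k => ∫ x, K (φ k) t x) atTop (𝓝 1) :=
    tendsto_const_nhds.congr' (by
      filter_upwards [hev] with k hk
      exact ((hK (φ k)).integral_eq_one t ⟨hk.le, ht⟩).symm)
  exact ⟨hB, hpos, hint, tendsto_nhds_unique hlim h1⟩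

/-! ### The limit on a window: very weak solution, hypoellipticity, identification -/

/-- **The limit is smooth and solves the adjoint equation classically on every window
`(a, 0)`.**  Along the tail of the subsequence living on the window the kernels are very weak
solutions (`kernelLimit_veryWeak_of_adapted`) and so is their pointwise limit
(`kernelLimit_veryWeak_limit`); Hörmander's hypoellipticity (`stub_hypoelliptic`) gives a smooth
classical solution `g` equal to the limit a.e.; for every time of the window the pairings of the
two with test functions agree (both are continuous in time and agree a.e.), so the continuous
slices agree a.e. (fundamental lemma of the calculus of variations) hence everywhere: the limit IS
`g` on the window. -/
theorem kernelCompactness_window {ν C₁ C₂ : ℝ}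
    {v : ℝ → EuclideanSpace ℝ (Fin 3) → EuclideanSpace ℝ (Fin 3)}
    {K : ℕ → ℝ → EuclideanSpace ℝ (Fin 3) → ℝ} (hν : 0 < ν) (hC₁ : 0 < C₁) (hC₂ : 0 < C₂)
    (hv : IsSmoothSpaceTimeOn (Iio 0) v)
    (hdiv : ∀ t ∈ Iio (0:ℝ), VectorCalculus.IsDivFree (v t))
    (hK : ∀ n : ℕ, IsAdaptedBackwardKernel ν v (Ico (-(n:ℝ) - 1) 0) 0 0 (K n))
    (hKU : ∀ n : ℕ, ∀ t ∈ Ico (-(n:ℝ) - 1) (0:ℝ), ∀ x,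
      K n t x ≤ C₁ * ((0:ℝ) - t) ^ (-(3:ℝ) / 2) *
        Real.exp (-(‖x - (0 : EuclideanSpace ℝ (Fin 3))‖ ^ 2) / (C₂ * ((0:ℝ) - t))))
    {φ : ℕ → ℕ} (hφ : StrictMono φ) {Glim : ℝ → EuclideanSpace ℝ (Fin 3) → ℝ}
    (hconv : ∀ t < (0:ℝ), ∀ x, Tendsto (fun k => K (φ k) t x) atTop (𝓝 (Glim t x)))
    (hGc : ∀ t < (0:ℝ), Continuous (Glim t))
    (hGp : ∀ ψ : EuclideanSpace ℝ (Fin 3) → ℝ, ContDiff ℝ ∞ ψ → HasCompactSupport ψ →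
      ContinuousOn (fun t => ∫ x, ψ x * Glim t x) (Iio 0))
    {a : ℝ} (ha : a < 0) :
    IsSmoothSpaceTimeOn (Ioo a 0) Glim ∧
      ∀ t ∈ Ioo a 0, ∀ x, deriv (fun s => Glim s x) t + fderiv ℝ (Glim t) x (v t x) +
        ν * (Δ (Glim t)) x = 0 := by
  -- the tail of the subsequence living on the window
  obtain ⟨N, hN⟩ := exists_nat_ge (-a - 1)
  set Gs : ℕ → ℝ → EuclideanSpace ℝ (Fin 3) → ℝ := fun k => K (φ (k + N)) with hGs
  have hwin : ∀ k : ℕ, -(φ (k + N) : ℝ) - 1 ≤ a := fun k => by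
    have h1 : N ≤ φ (k + N) := (Nat.le_add_left N k).trans (hφ.id_le (k + N))
    have h2 : (N:ℝ) ≤ φ (k + N) := by exact_mod_cast h1
    linarith
  have hIco : Ico a 0 ⊆ Iio 0 := Ico_subset_Iio_self
  have hv' : IsSmoothSpaceTimeOn (Ico a 0) v := hv.mono hIco
  have hdiv' : ∀ t ∈ Ico a 0, VectorCalculus.IsDivFree (v t) := fun t ht => hdiv t (hIco ht)
  have hK' : ∀ k, IsAdaptedBackwardKernel ν v (Ico a 0) 0 0 (Gs k) := fun k =>
    (hK (φ (k + N))).mono (Ico_subset_Ico_left (hwin k)) (uniqueDiffOn_Ico a 0)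
  have hconvW : ∀ t ∈ Ioo a 0, ∀ x, Tendsto (fun k => Gs k t x) atTop (𝓝 (Glim t x)) :=
    fun t ht x => (hconv t ht.2 x).comp (tendsto_add_atTop_nat N)
  have hO : IsOpen (Ioo a 0 ×ˢ (univ : Set (EuclideanSpace ℝ (Fin 3)))) :=
    isOpen_Ioo.prod isOpen_univ
  have hIoo : Ioo a 0 ⊆ Ico a 0 := Ioo_subset_Ico_self
  have hcontO : ∀ k, ContinuousOn (fun p : ℝ × EuclideanSpace ℝ (Fin 3) => Gs k p.1 p.2)
      (Ioo a 0 ×ˢ univ) :=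
    fun k => (hK' k).contDiffOn.continuousOn.mono (prod_mono hIoo Subset.rfl)
  have hboundO : ∀ t₂ : ℝ, t₂ < 0 → ∃ Mb : ℝ, ∀ k, ∀ t ∈ Ioc a t₂, ∀ x, |Gs k t x| ≤ Mb :=
    fun t₂ ht₂ => ⟨_, fun k t ht x =>
      kernelCompactness_sup_bound hC₁ hC₂ hK hKU ht₂ (φ (k + N)) ⟨(hwin k).trans ht.1.le, ht.2⟩ x⟩
  have hweakn : ∀ k, ∀ θ : ℝ × EuclideanSpace ℝ (Fin 3) → ℝ, ContDiff ℝ ∞ θ →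
      HasCompactSupport θ → tsupport θ ⊆ Ioo a 0 ×ˢ univ →
      ∫ p : ℝ × EuclideanSpace ℝ (Fin 3), Gs k p.1 p.2 * (deriv (fun s => θ (s, p.2)) p.1 +
        fderiv ℝ (fun y => θ (p.1, y)) p.2 (v p.1 p.2) -
          ν * (Δ (fun y => θ (p.1, y))) p.2) = 0 :=
    fun k θ hθ hθc hθs => kernelLimit_veryWeak_of_adapted hv' hdiv' (hK' k) hθ hθc hθs
  have hloc := kernelLimit_locallyIntegrableOn_limit hcontO hboundO hconvW
  have hweak := kernelLimit_veryWeak_limit (ν := ν) (bs := fun _ : ℕ => v)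
    (Tn := fun _ : ℕ => (0:ℝ)) hv' (fun t ht => ⟨0, fun n _ => ht.le⟩) (fun n t _ => rfl)
    hcontO hboundO hconvW hweakn
  obtain ⟨g, hgs, hae, hcl⟩ :=
    stub_hypoelliptic ν a 0 v (fun p => Glim p.1 p.2) hν ha hv' hdiv' hloc hweak
  -- identification `Glim = g` everywhere on the window
  have hgc : ContinuousOn (fun p : ℝ × EuclideanSpace ℝ (Fin 3) => g p.1 p.2)
      (Ioo a 0 ×ˢ univ) := hgs.continuousOn
  have hgslice : ∀ t ∈ Ioo a 0, Continuous (g t) := fun t ht =>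
    (hgs.contDiff_slice ht).continuous
  have heq : ∀ t ∈ Ioo a 0, ∀ x, Glim t x = g t x := by
    intro t ht
    -- pairings with test functions agree at EVERY time of the window
    have hpair : ∀ ψ : EuclideanSpace ℝ (Fin 3) → ℝ, ContDiff ℝ ∞ ψ → HasCompactSupport ψ →
        ∫ x, ψ x * Glim t x = ∫ x, ψ x * g t x := by
      intro ψ hψ hψc
      have hcg : ContinuousOn (fun r => ∫ x, ψ x * g r x) (Ioo a 0) := by
        refine continuousOn_integral_of_compact_support (k := tsupport ψ) hψc ?_ ?_
        · exact ((hψ.continuous.comp continuous_snd).continuousOn).mul hgc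
        · intro r x _ hx
          simp [image_eq_zero_of_notMem_tsupport hx]
      have hae_t : ∀ᵐ r ∂(volume : Measure ℝ), r ∈ Ioo a 0 →
          ∫ x, ψ x * Glim r x = ∫ x, ψ x * g r x := by
        filter_upwards [kernelLimit_ae_ae hae] with r hr hrI
        refine integral_congr_ae ?_
        filter_upwards [hr] with x hx
        rw [hx ⟨hrI, mem_univ x⟩]
      have hae' : (fun r => ∫ x, ψ x * Glim r x) =ᵐ[volume.restrict (Ioo a 0)]
          fun r => ∫ x, ψ x * g r x := by
        rw [EventuallyEq, ae_restrict_iff' measurableSet_Ioo]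
        exact hae_t
      exact Measure.eqOn_open_of_ae_eq hae' isOpen_Ioo
        ((hGp ψ hψ hψc).mono Ioo_subset_Iio_self) hcg ht
    have hGt : Continuous (Glim t) := hGc t ht.2
    have hgt : Continuous (g t) := hgslice t ht
    have hz : ∀ᵐ x ∂(volume : Measure (EuclideanSpace ℝ (Fin 3))), Glim t x - g t x = 0 := by
      refine ae_eq_zero_of_integral_contDiff_smul_eq_zero (hGt.sub hgt).locallyIntegrable
        fun ψ hψ hψc => ?_
      have hi1 : Integrable fun x => ψ x * Glim t x :=
        (hψ.continuous.mul hGt).integrable_of_hasCompactSupport hψc.mul_right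
      have hi2 : Integrable fun x => ψ x * g t x :=
        (hψ.continuous.mul hgt).integrable_of_hasCompactSupport hψc.mul_right
      simp_rw [smul_eq_mul, mul_sub]
      rw [integral_sub hi1 hi2, hpair ψ hψ hψc, sub_self]
    have hfun := Measure.eq_of_ae_eq (f := fun x => Glim t x - g t x) (g := fun _ => (0:ℝ)) hz
      (hGt.sub hgt) continuous_const
    intro x
    exact sub_eq_zero.1 (congr_fun hfun x)
  refine ⟨hgs.congr fun p hp => heq p.1 hp.1 p.2, fun t ht x => ?_⟩
  have hderiv : deriv (fun s => Glim s x) t = deriv (fun s => g s x) t := by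
    refine Filter.EventuallyEq.deriv_eq ?_
    filter_upwards [Ioo_mem_nhds ht.1 ht.2] with s hs
    exact heq s hs x
  have hslice : Glim t = g t := funext fun y => heq t ht y
  rw [hderiv, hslice]
  exact hcl t ht x

/-! ### The registered stub -/

/-- **Registered STUB `stub_kernelCompactness` (S4, the wall engine) of line
`moving-adjoint-bernoulli` of crux `FrequencyRigidity`.**  Adapted backward kernels of ONE
smooth divergence-free locally bounded drift `v` on `(−∞, 0) × ℝ³`, given on the growing windows
`[−n−1, 0)` with pole `(0, 0)` and all squeezed between the same two Gaussians, converge along a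
subsequence at every `(t, x)`, `t < 0`, to an adapted backward kernel of `v` on `(−∞, 0)` between
the same Gaussians. -/
theorem stub_kernelCompactness :
    ∀ (ν c₁ c₂ C₁ C₂ : ℝ) (v : ℝ → EuclideanSpace ℝ (Fin 3) → EuclideanSpace ℝ (Fin 3)) (K : ℕ → ℝ → EuclideanSpace ℝ (Fin 3) → ℝ),
      0 < ν → 0 < c₁ → 0 < c₂ → 0 < C₁ → 0 < C₂ →
      Literature.Analysis.FluidPDE.IsSmoothSpaceTimeOn (Set.Iio 0) v →
      (∀ t ∈ Set.Iio (0:ℝ), Literature.Analysis.FluidPDE.VectorCalculus.IsDivFree (v t)) →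
      (∀ a b : ℝ, a < b → b < 0 → ∃ B : ℝ, ∀ t ∈ Set.Icc a b, ∀ x, ‖v t x‖ ≤ B) →
      (∀ n : ℕ, Literature.Analysis.FluidPDE.IsAdaptedBackwardKernel ν v (Set.Ico (-(n:ℝ) - 1) 0) 0 0 (K n) ∧
        ∀ t ∈ Set.Ico (-(n:ℝ) - 1) (0:ℝ), ∀ x,
          c₁ * ((0:ℝ) - t) ^ (-(3:ℝ) / 2) * Real.exp (-(‖x - (0 : EuclideanSpace ℝ (Fin 3))‖ ^ 2) / (c₂ * ((0:ℝ) - t))) ≤ K n t x ∧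
          K n t x ≤ C₁ * ((0:ℝ) - t) ^ (-(3:ℝ) / 2) * Real.exp (-(‖x - (0 : EuclideanSpace ℝ (Fin 3))‖ ^ 2) / (C₂ * ((0:ℝ) - t)))) →
      ∃ (G : ℝ → EuclideanSpace ℝ (Fin 3) → ℝ) (φ : ℕ → ℕ), StrictMono φ ∧
        Literature.Analysis.FluidPDE.IsAdaptedBackwardKernel ν v (Set.Iio 0) 0 0 G ∧
        (∀ t ∈ Set.Iio (0:ℝ), ∀ x,
          c₁ * ((0:ℝ) - t) ^ (-(3:ℝ) / 2) * Real.exp (-(‖x - (0 : EuclideanSpace ℝ (Fin 3))‖ ^ 2) / (c₂ * ((0:ℝ) - t))) ≤ G t x ∧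
          G t x ≤ C₁ * ((0:ℝ) - t) ^ (-(3:ℝ) / 2) * Real.exp (-(‖x - (0 : EuclideanSpace ℝ (Fin 3))‖ ^ 2) / (C₂ * ((0:ℝ) - t)))) ∧
        (∀ t ∈ Set.Iio (0:ℝ), ∀ x,
          Filter.Tendsto (fun n => K (φ n) t x) Filter.atTop (nhds (G t x))) := by
  intro ν c₁ c₂ C₁ C₂ v K hν hc₁ hc₂ hC₁ hC₂ hv hdiv hbd hKall
  have hK : ∀ n : ℕ, IsAdaptedBackwardKernel ν v (Ico (-(n:ℝ) - 1) 0) 0 0 (K n) :=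
    fun n => (hKall n).1
  have hKB : ∀ n : ℕ, ∀ t ∈ Ico (-(n:ℝ) - 1) (0:ℝ), ∀ x,
      c₁ * ((0:ℝ) - t) ^ (-(3:ℝ) / 2) *
          Real.exp (-(‖x - (0 : EuclideanSpace ℝ (Fin 3))‖ ^ 2) / (c₂ * ((0:ℝ) - t))) ≤ K n t x ∧
        K n t x ≤ C₁ * ((0:ℝ) - t) ^ (-(3:ℝ) / 2) *
          Real.exp (-(‖x - (0 : EuclideanSpace ℝ (Fin 3))‖ ^ 2) / (C₂ * ((0:ℝ) - t))) :=
    fun n => (hKall n).2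
  have hKU : ∀ n : ℕ, ∀ t ∈ Ico (-(n:ℝ) - 1) (0:ℝ), ∀ x,
      K n t x ≤ C₁ * ((0:ℝ) - t) ^ (-(3:ℝ) / 2) *
        Real.exp (-(‖x - (0 : EuclideanSpace ℝ (Fin 3))‖ ^ 2) / (C₂ * ((0:ℝ) - t))) :=
    fun n t ht x => (hKB n t ht x).2
  obtain ⟨φ, hφ, G, hconv⟩ := kernelCompactness_extract hν hC₁ hC₂ hv hdiv hbd hK hKU
  have hGc : ∀ t < (0:ℝ), Continuous (G t) := fun t ht =>
    kernelCompactness_continuous_slice hν hC₁ hC₂ hv hbd hK hKU hφ hconv ht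
  have hGp : ∀ ψ : EuclideanSpace ℝ (Fin 3) → ℝ, ContDiff ℝ ∞ ψ → HasCompactSupport ψ →
      ContinuousOn (fun t => ∫ x, ψ x * G t x) (Iio 0) := fun ψ hψ hψc =>
    kernelCompactness_pairing_continuousOn hν hC₁ hC₂ hv hdiv hbd hK hKU hφ hconv hψ hψc
  have hsl := fun (t : ℝ) (ht : t < 0) =>
    kernelCompactness_limit_slice hc₁ hC₂ hK hKB hφ hconv ht (hGc t ht)
  have hwin := fun (a : ℝ) (ha : a < 0) =>
    kernelCompactness_window hν hC₁ hC₂ hv hdiv hK hKU hφ hconv hGc hGp ha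
  refine ⟨G, φ, hφ, ⟨?_, fun t ht x => (hsl t ht).2.1 x, ?_, fun t ht => (hsl t ht).2.2.2, ?_⟩,
    fun t ht x => (hsl t ht).1 x, fun t ht x => hconv t ht x⟩
  · -- jointly `C²` on `Iio 0 × ℝ³`: locally the limit is the smooth solution of a window
    intro p hp
    have hp1 : p.1 < 0 := hp.1
    have hpO : p ∈ Ioo (p.1 - 1) 0 ×ˢ (univ : Set (EuclideanSpace ℝ (Fin 3))) :=
      ⟨⟨by linarith, hp1⟩, mem_univ _⟩
    have h1 : ContDiffWithinAt ℝ 2 (uncurry G) (Ioo (p.1 - 1) 0 ×ˢ univ) p :=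
      ((hwin (p.1 - 1) (by linarith)).1 p hpO).of_le (by norm_cast)
    exact (h1.contDiffAt ((isOpen_Ioo.prod isOpen_univ).mem_nhds hpO)).contDiffWithinAt
  · -- the adjoint equation: on the open time set the one-sided time derivative is `deriv`
    intro t ht x
    have ht0 : t < 0 := ht
    rw [timeDerivWithin_eq_deriv isOpen_Iio ht]
    exact (hwin (t - 1) (by linarith)).2 t ⟨by linarith, ht0⟩ x
  · -- concentration at the pole from the Gaussian upper bound and unit mass
    intro θ hθ hM
    obtain ⟨M, hM⟩ := hM
    exact kernelLimit_concentration (t₁ := -1) hC₁ hC₂ (by norm_num)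
      (fun t ht x => ((hsl t ht.2).2.1 x).le) (fun t ht => (hsl t ht.2).2.2.1)
      (fun t ht => (hsl t ht.2).2.2.2) (fun t ht x => ((hsl t ht.2).1 x).2) hθ hM

end Summit.NavierStokesRegularity.NavierStokesRegularity.Theorems.FrequencyRigidity.MovingAdjointBernoulli

end
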